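import Summits.ResolutionOfSingularities.ResolutionOfSingularities.Theorems.EquisingularLiftEquisingularLiftNatSubchainPointResolutionOff
import Literature.AlgebraicGeometry.Resolution.ProjectiveSpaceRegular
import HarnessLib

/-!
# [OURS · L1 W4.5(b) · EL♮ / EL♮(3)] K5⁰ — THE ZERO-PREFIX ENGINE `target_elnat_of_initialReach`: EL♮'s conclusion from ONE admissible
# downstairs move made AT THE INITIAL STAGE `(ℙⁿ_k, range ι)` and its upstairs supplier HSUB₀(Reach₀)

res-L1-w45b-stub-2 g15 (NOSE WORD v1.1 §2/§5: the (R-ν1) rung «unobstructed nose FIRST» has no point prefix, so K5′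
`target_elnat_of_subchainResolution'` (…NatSubchainPointResolutionOff; its `Reach` slot hangs off a point step) does not serve it; this file is
K5′ with ZERO point steps). OURS; assembly vocabulary of the crux chain, NOT a statement of any manuscript; AI-written, weaker than expert
review. No `sorry`; standard axioms; DEF-FREE (parametric in the move predicate `Reach₀`). `--supports stmt-ResolutionOfSingularities-20148 --as helper`.

WHAT. `target_elnat_of_initialReach (Reach₀)`: for `p` prime, `k = k̄` of characteristic `p`, `ι : H ↪ ℙⁿ_k` an integral closed subscheme with
locally principal ideal, a SUPPLIER `HSUB₀(Reach₀)` — in the engine context (base `q : P ⟶ Spec O`, closed irreducible `Y` in the special fibre, stage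
predicate `Ch` closed under horizontal E1 steps and implying `Split.Chain`; K5′'s binders VERBATIM) at a `Ch`-stage `(X', σ', S')` with model square
`(F₁, j, t)`, `j '' T₁ = S'` AND `F₁` regular (true at the initial stage, the only place the engine calls it), every `Reach₀ F₁ T₁ F' β T'` is matched
by a `Ch`-stage with a model square for `F'` and `j₉ '' T' = S₉` — and the downstairs hypothesis `∃ F' β T', Reach₀ ℙⁿ_k (range ι) F' β T' ∧ T̂'
regular` give EL♮'s conclusion (`ELNatConclusionO k n H ι` of …NatResidueHypDefs, stated UNFOLDED here so that this generic
file stays outside the theses cone). PROOF = the initial-stage half of this seat's `stub_elnat_defNoseTowerResolution_of_hsubDatum₇`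
(…NatDefNoseTowerResolutionOfHsub: Witt ring `stub_wittRing`, `ℙⁿ_O` smooth proper, base model square `isPullback_projMap`, the minimal stage predicate
`Ch`, `isRegular_projectiveSpace`) + ONE supplier call + the END transport `isRegular_subscheme_vanishingIdeal_image_iff`. [folklore; pure composition]
-/

set_option linter.dupNamespace false -- mandated namespace `Summit.<Summit>.<Problem>` of this single-conjunct summit
set_option linter.overlappingInstances false -- signatures carry `[IsDomain O] [IsDiscreteValuationRing O]`

noncomputable section

open CategoryTheory CategoryTheory.Limits AlgebraicGeometry TopologicalSpace Topology
open MvPolynomial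
open Literature.AlgebraicGeometry.Resolution
open AlgebraicGeometry.Scheme.IdealSheafData
open Summit.ResolutionOfSingularities.ResolutionOfSingularities.Theses.EquisingularLift.Split
open Summit.ResolutionOfSingularities.ResolutionOfSingularities.Cruxes.EquisingularLift.StrataSplit

namespace Summit.ResolutionOfSingularities.ResolutionOfSingularities.Cruxes.EquisingularLiftNat.Sections

/-- **K5⁰: the zero-prefix engine** — EL♮'s conclusion (`ELNatConclusionO k n H ι`, unfolded) from ONE `Reach₀`-move at the initial stage `(ℙⁿ_k, range ι)`
ending at a stage whose reduced closed strict transform is regular, given the upstairs supplier `HSUB₀(Reach₀)` (K5′'s engine context and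
stage/model binders verbatim, plus `F₁` regular, then `∀ F' β T', Reach₀ F₁ T₁ F' β T' → ∃` `Ch`-stage with model square). See the module docstring.
[folklore; pure composition] [OURS · L1 W4.5b] -/
theorem target_elnat_of_initialReach (p : ℕ)
    (Reach₀ : ∀ (F₁ : AlgebraicGeometry.Scheme.{0}) (T₁ : Set F₁) (F' : AlgebraicGeometry.Scheme.{0}) (β : F' ⟶ F₁) (T' : Set F'), Prop) :
    p.Prime →
      ∀ (k : Type) [Field k] [CharP k p] [IsAlgClosed k] (n : ℕ) (H : AlgebraicGeometry.Scheme.{0}) (ι : H ⟶ (Literature.AlgebraicGeometry.Motives.projectiveSpace n k).left), AlgebraicGeometry.IsClosedImmersion ι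
      → AlgebraicGeometry.IsIntegral H →
      (∀ y : (Literature.AlgebraicGeometry.Motives.projectiveSpace n k).left, ∃ U : (Literature.AlgebraicGeometry.Motives.projectiveSpace n k).left.affineOpens, y ∈ (U : (Literature.AlgebraicGeometry.Motives.projectiveSpace n k).left.Opens)
      ∧ (ι.ker.ideal U).IsPrincipal) →
      (∀ (O : Type) [CommRing O] [IsDomain O] [IsDiscreteValuationRing O] [IsAdicComplete (IsLocalRing.maximalIdeal O) O] [IsAlgClosed (IsLocalRing.ResidueField O)] (θ : O →+* k), Function.Surjective θ
      → ∀ (P : AlgebraicGeometry.Scheme.{0}) (q : P ⟶ AlgebraicGeometry.Spec (.of O)) (Y : Set P) (Ch : ∀ X' : AlgebraicGeometry.Scheme.{0}, (X' ⟶ P) → Set X' →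
      Prop), (∀ (X' X'' : AlgebraicGeometry.Scheme.{0}) (σ' : X' ⟶ P) (S' : Set X') (C : X'.IdealSheafData) (τ : X'' ⟶ X'), Ch X' σ' S' →
      Literature.AlgebraicGeometry.Resolution.IsBlowup τ C → Literature.AlgebraicGeometry.Resolution.Scheme.IsRegular C.subscheme →
      AlgebraicGeometry.Flat (C.subschemeι ≫ σ' ≫ q) → σ' '' (C.support : Set X') ⊆ {y | ¬ IsGenericPoint y Y} →
      (C.support : Set X') ∩ (σ' ≫ q) ⁻¹' {IsLocalRing.closedPoint O} ⊆ S' → Ch X'' (τ ≫ σ') (closure (τ ⁻¹' (S' \ (C.support : Set X'))))) →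
      (∀ (X' : AlgebraicGeometry.Scheme.{0}) (σ' : X' ⟶ P) (S' : Set X'), Ch X' σ' S' →
      Summit.ResolutionOfSingularities.ResolutionOfSingularities.Theses.EquisingularLift.Split.Chain P Y X' σ' S') → Y ⊆ q ⁻¹' {IsLocalRing.closedPoint O} →
      IsIrreducible Y → IsClosed Y → AlgebraicGeometry.IsIntegral P → IsLocallyNoetherian P → Literature.AlgebraicGeometry.Resolution.Scheme.IsRegular P →
      AlgebraicGeometry.IsProper q → AlgebraicGeometry.SmoothOfRelativeDimension n q → ∀ (X' : AlgebraicGeometry.Scheme.{0}) (σ' : X' ⟶ P) (S' : Set X'), Ch X' σ' S' →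
      AlgebraicGeometry.IsIntegral X' → IsLocallyNoetherian X' → Literature.AlgebraicGeometry.Resolution.Scheme.IsRegular X' → AlgebraicGeometry.IsDominant (σ' ≫ q) →
      ∀ (F₁ : AlgebraicGeometry.Scheme.{0}), AlgebraicGeometry.IsIntegral F₁ →
      ∀ (j : F₁ ⟶ X') (t : F₁ ⟶ AlgebraicGeometry.Spec (.of k)), IsPullback j t (σ' ≫ q) (AlgebraicGeometry.Spec.map (CommRingCat.ofHom θ)) → ∀ (T₁ : Set F₁), IsClosed T₁
      → IsIrreducible T₁ → j '' T₁ = S' → Literature.AlgebraicGeometry.Resolution.Scheme.IsRegular F₁ →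
      ∀ (F' : AlgebraicGeometry.Scheme.{0}) (β : F' ⟶ F₁) (T' : Set F'), Reach₀ F₁ T₁ F' β T' →
      ∃ (X₉ : AlgebraicGeometry.Scheme.{0}) (σ₉ : X₉ ⟶ P) (S₉ : Set X₉) (j₉ : F' ⟶ X₉) (t₉ : F' ⟶ AlgebraicGeometry.Spec (.of k)), Ch X₉ σ₉ S₉ ∧
      AlgebraicGeometry.IsIntegral X₉ ∧ IsLocallyNoetherian X₉ ∧ Literature.AlgebraicGeometry.Resolution.Scheme.IsRegular X₉ ∧ AlgebraicGeometry.IsDominant (σ₉ ≫ q) ∧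
      IsPullback j₉ t₉ (σ₉ ≫ q) (AlgebraicGeometry.Spec.map (CommRingCat.ofHom θ)) ∧ j₉ '' T' = S₉ ∧ IsClosed T' ∧ IsIrreducible T' ∧ AlgebraicGeometry.IsIntegral F')  →
      (∃ (F' : AlgebraicGeometry.Scheme.{0}) (β : F' ⟶ (Literature.AlgebraicGeometry.Motives.projectiveSpace n k).left) (T' : Set F'), Reach₀ (Literature.AlgebraicGeometry.Motives.projectiveSpace n k).left (Set.range ι) F' β T'
      ∧ Literature.AlgebraicGeometry.Resolution.Scheme.IsRegular
        (AlgebraicGeometry.Scheme.IdealSheafData.vanishingIdeal (⟨closure T', isClosed_closure⟩ : TopologicalSpace.Closeds F')).subscheme)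
      → ∃ (O : Type) (_ : CommRing O) (_ : IsDomain O) (_ : IsDiscreteValuationRing O) (_ : CharZero O) (π : O →+* k), Function.Surjective π ∧
      (letI := MvPolynomial.gradedAlgebra (σ := Fin (n + 1)) (R := O); letI := MvPolynomial.gradedAlgebra (σ := Fin (n + 1)) (R := k); ∀ (φ : MvPolynomial.homogeneousSubmodule (Fin (n + 1)) O →+*ᵍ MvPolynomial.homogeneousSubmodule (Fin (n + 1)) k) (hφ' : HomogeneousIdeal.irrelevant (MvPolynomial.homogeneousSubmodule (Fin (n + 1)) k) ≤ (HomogeneousIdeal.irrelevant (MvPolynomial.homogeneousSubmodule (Fin (n + 1)) O)).map φ), (∀ s, φ s = MvPolynomial.map π s)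
      →
      ∀ Y : Set (AlgebraicGeometry.Proj (MvPolynomial.homogeneousSubmodule (Fin (n + 1)) O)), Y = Set.range (CategoryTheory.CategoryStruct.comp ι (AlgebraicGeometry.Proj.map φ hφ') : H ⟶ (AlgebraicGeometry.Proj (MvPolynomial.homogeneousSubmodule (Fin (n + 1)) O)))
      →
      ∃ (P' : AlgebraicGeometry.Scheme.{0}) (σ : P' ⟶ (AlgebraicGeometry.Proj (MvPolynomial.homogeneousSubmodule (Fin (n + 1)) O))) (S' : Set P'), (∀ Q : (∀ X' : AlgebraicGeometry.Scheme.{0}, (X' ⟶ (AlgebraicGeometry.Proj (MvPolynomial.homogeneousSubmodule (Fin (n + 1)) O)))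
      → Set X' → Prop), Q (AlgebraicGeometry.Proj (MvPolynomial.homogeneousSubmodule (Fin (n + 1)) O)) (CategoryTheory.CategoryStruct.id _) Y →
      (∀ (X' X'' : AlgebraicGeometry.Scheme.{0}) (σ' : X' ⟶ (AlgebraicGeometry.Proj (MvPolynomial.homogeneousSubmodule (Fin (n + 1)) O))) (Y' : Set X') (C : X'.IdealSheafData) (τ : X'' ⟶ X'), Q X' σ' Y'
      → Literature.AlgebraicGeometry.Resolution.IsBlowup τ C → Literature.AlgebraicGeometry.Resolution.Scheme.IsRegular C.subscheme →
      AlgebraicGeometry.Flat (CategoryTheory.CategoryStruct.comp C.subschemeι (CategoryTheory.CategoryStruct.comp σ' (CategoryTheory.CategoryStruct.comp (AlgebraicGeometry.Proj.toSpecZero (MvPolynomial.homogeneousSubmodule (Fin (n + 1)) O)) (AlgebraicGeometry.Spec.map (CommRingCat.ofHom (algebraMap O (MvPolynomial.homogeneousSubmodule (Fin (n + 1)) O 0)))))))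
      → σ' '' (C.support : Set X') ⊆ {x | ¬ IsGenericPoint x Y} →
      (C.support : Set X') ∩ (CategoryTheory.CategoryStruct.comp σ' (CategoryTheory.CategoryStruct.comp (AlgebraicGeometry.Proj.toSpecZero (MvPolynomial.homogeneousSubmodule (Fin (n + 1)) O)) (AlgebraicGeometry.Spec.map (CommRingCat.ofHom (algebraMap O (MvPolynomial.homogeneousSubmodule (Fin (n + 1)) O 0)))))) ⁻¹' {IsLocalRing.closedPoint O} ⊆ Y'
      → Q X'' (CategoryTheory.CategoryStruct.comp τ σ') (closure (τ ⁻¹' (Y' \ (C.support : Set X'))))) → Q P' σ S') ∧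
      Literature.AlgebraicGeometry.Resolution.Scheme.IsRegular (AlgebraicGeometry.Scheme.IdealSheafData.vanishingIdeal (⟨closure S', isClosed_closure⟩ : TopologicalSpace.Closeds P')).subscheme) := by
  classical
  intro hp k _ _ _ n H ι hι hH hpr hsub hreach
  obtain ⟨F', β, T', hR, hregD⟩ := hreach
  obtain ⟨O, i1, i2, i3, i4, i5, i6, π, hπ⟩ := stub_wittRing p hp k
  refine ⟨O, i1, i2, i3, i4, π, hπ, ?_⟩
  letI := MvPolynomial.gradedAlgebra (σ := Fin (n + 1)) (R := O)
  letI := MvPolynomial.gradedAlgebra (σ := Fin (n + 1)) (R := k)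
  intro φ hφ' hφ Y hYdef
  subst hYdef
  set q : Proj (homogeneousSubmodule (Fin (n + 1)) O) ⟶ Spec (.of O) :=
    Proj.toSpecZero (homogeneousSubmodule (Fin (n + 1)) O) ≫
      Spec.map (CommRingCat.ofHom (algebraMap O (homogeneousSubmodule (Fin (n + 1)) O 0))) with hq
  have hP := ProjectiveAmbientFibre.isPullback_projMap π φ hφ hπ hφ'
  set g : Proj (homogeneousSubmodule (Fin (n + 1)) k) ⟶ Proj (homogeneousSubmodule (Fin (n + 1)) O) :=
    Proj.map φ hφ' with hg
  haveI : IsClosedImmersion (Spec.map (CommRingCat.ofHom π)) := IsClosedImmersion.spec_of_surjective _ hπ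
  haveI : IsClosedImmersion g := MorphismProperty.IsStableUnderBaseChange.of_isPullback hP.flip inferInstance
  have hsq₀ : IsPullback g (Proj.toSpecZero (homogeneousSubmodule (Fin (n + 1)) k) ≫
      Spec.map (CommRingCat.ofHom (algebraMap k (homogeneousSubmodule (Fin (n + 1)) k 0))))
      (𝟙 _ ≫ q) (Spec.map (CommRingCat.ofHom π)) := by
    rw [Category.id_comp]; exact hP
  have hrangeg : Set.range g = q ⁻¹' {IsLocalRing.closedPoint O} := by
    rw [range_eq_preimage_of_isPullback hP, range_specMap_of_surjective_of_field π hπ]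
  haveI := hH
  let ι' : H ⟶ Proj (homogeneousSubmodule (Fin (n + 1)) k) := ι
  haveI : IsClosedImmersion ι' := hι
  let f : H ⟶ Proj (homogeneousSubmodule (Fin (n + 1)) O) := ι' ≫ g
  let Yc : Closeds (Proj (homogeneousSubmodule (Fin (n + 1)) O)) := ⟨Set.range f, f.isClosedEmbedding.isClosed_range⟩
  have hYs : (Yc : Set (Proj (homogeneousSubmodule (Fin (n + 1)) O))) ⊆ q ⁻¹' {IsLocalRing.closedPoint O} := by
    rintro _ ⟨x, rfl⟩
    rw [← hrangeg]
    exact ⟨ι' x, (Scheme.Hom.comp_apply _ _ x).symm⟩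
  obtain ⟨hsm, hprop⟩ := stub_projectiveAmbientSmoothProper O n
  haveI : IsProper q := hprop
  have hYirr : IsIrreducible (Yc : Set (Proj (homogeneousSubmodule (Fin (n + 1)) O))) := by
    have h := (IrreducibleSpace.isIrreducible_univ H).image f f.continuous.continuousOn
    rwa [Set.image_univ] at h
  obtain ⟨Ch, hCh⟩ : ∃ Ch : ∀ X' : Scheme.{0}, (X' ⟶ Proj (homogeneousSubmodule (Fin (n + 1)) O)) → Set X' → Prop,
      ∀ (X₁ : Scheme.{0}) (σ₁ : X₁ ⟶ Proj (homogeneousSubmodule (Fin (n + 1)) O)) (S₁ : Set X₁), Ch X₁ σ₁ S₁ ↔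
      ∀ Q : (∀ X' : Scheme.{0}, (X' ⟶ Proj (homogeneousSubmodule (Fin (n + 1)) O)) → Set X' → Prop),
        Q (Proj (homogeneousSubmodule (Fin (n + 1)) O)) (𝟙 _) (Yc : Set (Proj (homogeneousSubmodule (Fin (n + 1)) O))) →
        (∀ (X' X'' : Scheme.{0}) (σ' : X' ⟶ Proj (homogeneousSubmodule (Fin (n + 1)) O)) (Y' : Set X')
          (C : X'.IdealSheafData) (τ : X'' ⟶ X'), Q X' σ' Y' → IsBlowup τ C → Scheme.IsRegular C.subscheme →
          Flat (C.subschemeι ≫ σ' ≫ q) →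
          σ' '' (C.support : Set X') ⊆ {x | ¬ IsGenericPoint x (Yc : Set (Proj (homogeneousSubmodule (Fin (n + 1)) O)))} →
          (C.support : Set X') ∩ (σ' ≫ q) ⁻¹' {IsLocalRing.closedPoint O} ⊆ Y' →
          Q X'' (τ ≫ σ') (closure (τ ⁻¹' (Y' \ (C.support : Set X'))))) →
        Q X₁ σ₁ S₁ := ⟨_, fun _ _ _ => Iff.rfl⟩
  have hChain : ∀ (X' : Scheme.{0}) (σ : X' ⟶ Proj (homogeneousSubmodule (Fin (n + 1)) O)) (S : Set X'),
      Ch X' σ S → Chain (Proj (homogeneousSubmodule (Fin (n + 1)) O))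
        (Yc : Set (Proj (homogeneousSubmodule (Fin (n + 1)) O))) X' σ S :=
    fun X' σ S h Q h0 hs => (hCh X' σ S).mp h Q h0
      (fun X₁ X₂ σ' Y' C τ hQ hb hr _ hg' _ => hs X₁ X₂ σ' Y' C τ hQ hb hr hg')
  have hStep : ∀ (X' X'' : Scheme.{0}) (σ' : X' ⟶ Proj (homogeneousSubmodule (Fin (n + 1)) O)) (S' : Set X')
      (C : X'.IdealSheafData) (τ : X'' ⟶ X'),
      Ch X' σ' S' → IsBlowup τ C → Scheme.IsRegular C.subscheme → Flat (C.subschemeι ≫ σ' ≫ q) →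
      σ' '' (C.support : Set X') ⊆ {x | ¬ IsGenericPoint x (Yc : Set (Proj (homogeneousSubmodule (Fin (n + 1)) O)))} →
      (C.support : Set X') ∩ (σ' ≫ q) ⁻¹' {IsLocalRing.closedPoint O} ⊆ S' →
      Ch X'' (τ ≫ σ') (closure (τ ⁻¹' (S' \ (C.support : Set X')))) :=
    fun X' X'' σ' S' C τ h hb hr hfl hg' hE => (hCh _ _ _).mpr fun Q h0 hs =>
      hs X' X'' σ' S' C τ ((hCh X' σ' S').mp h Q h0 hs) hb hr hfl hg' hE
  have hCh₀ : Ch (Proj (homogeneousSubmodule (Fin (n + 1)) O)) (𝟙 _)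
      (Yc : Set (Proj (homogeneousSubmodule (Fin (n + 1)) O))) := (hCh _ _ _).mpr fun Q h0 _ => h0
  haveI hPnoeth : IsLocallyNoetherian (Proj (homogeneousSubmodule (Fin (n + 1)) O)) :=
    LocallyOfFiniteType.isLocallyNoetherian q
  have hPreg : Scheme.IsRegular (Proj (homogeneousSubmodule (Fin (n + 1)) O)) := fun y => (stub_goodAtOfSmooth O _ q hsm y).1
  haveI hPint : IsIntegral (Proj (homogeneousSubmodule (Fin (n + 1)) O)) :=
    Proj.isIntegral _ (irrelevant_homogeneousSubmodule_ne_bot n O)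
  haveI hsrd : SmoothOfRelativeDimension n q := smoothOfRelativeDimension_toSpecZero_specMap n O
  haveI : Nonempty H := inferInstance
  haveI : Nonempty (Proj (homogeneousSubmodule (Fin (n + 1)) O)) := ⟨f (Classical.arbitrary H)⟩
  haveI : Smooth q := hsm
  haveI : IsDominant q := isDominant_of_smooth_of_nonempty q
  have hdom₀ : IsDominant (𝟙 (Proj (homogeneousSubmodule (Fin (n + 1)) O)) ≫ q) := by
    rw [Category.id_comp]; infer_instance
  have hirrι : IsIrreducible (Set.range ι') := by
    have h := (IrreducibleSpace.isIrreducible_univ H).image ι' ι'.continuous.continuousOn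
    rwa [Set.image_univ] at h
  have hT₁cl : IsClosed (Set.range ι') := ι'.isClosedEmbedding.isClosed_range
  haveI hF₁ : IsIntegral (Proj (homogeneousSubmodule (Fin (n + 1)) k)) := isIntegral_proj_homogeneousSubmodule n k
  have hF₁reg : Scheme.IsRegular (Proj (homogeneousSubmodule (Fin (n + 1)) k)) := isRegular_projectiveSpace n k
  have hTS : g '' Set.range ι' = (Yc : Set (Proj (homogeneousSubmodule (Fin (n + 1)) O))) := by
    change g '' Set.range ι' = Set.range f
    rw [← Set.range_comp]
    rfl
  -- ONE supplier call at the initial stage `(ℙⁿ_O, 𝟙, Y)` with model `ℙⁿ_k`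
  obtain ⟨X₉, σ₉, S₉, j₉, t₉, hCh₉, -, -, -, -, hsq₉, hsets₉, hT'cl, -, -⟩ :=
    hsub O π hπ _ q (Yc : Set (Proj (homogeneousSubmodule (Fin (n + 1)) O))) Ch hStep hChain hYs hYirr Yc.isClosed
      hPint hPnoeth hPreg hprop hsrd _ (𝟙 _) (Yc : Set (Proj (homogeneousSubmodule (Fin (n + 1)) O))) hCh₀ hPint hPnoeth hPreg hdom₀
      _ hF₁ g _ hsq₀ (Set.range ι') hT₁cl hirrι hTS hF₁reg F' β T' hR
  -- the END transport
  haveI hj₉ci : IsClosedImmersion j₉ := MorphismProperty.IsStableUnderBaseChange.of_isPullback hsq₉.flip inferInstance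
  have hT'img : IsClosed (j₉ '' T') := hj₉ci.isClosedEmbedding.isClosedMap _ hT'cl
  have hZ1 : (⟨closure T', isClosed_closure⟩ : Closeds F') = ⟨T', hT'cl⟩ := Closeds.ext hT'cl.closure_eq
  have hZ2 : (⟨closure S₉, isClosed_closure⟩ : Closeds X₉) = ⟨j₉ '' T', hT'img⟩ :=
    Closeds.ext (by change closure S₉ = j₉ '' T'; rw [← hsets₉]; exact hT'img.closure_eq)
  change Scheme.IsRegular (vanishingIdeal (⟨closure T', isClosed_closure⟩ : Closeds F')).subscheme at hregD
  rw [hZ1] at hregD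
  refine ⟨X₉, σ₉, S₉, (hCh X₉ σ₉ S₉).mp hCh₉, ?_⟩
  rw [hZ2]
  exact (isRegular_subscheme_vanishingIdeal_image_iff j₉ ⟨T', hT'cl⟩ hT'img).mpr hregD

end Summit.ResolutionOfSingularities.ResolutionOfSingularities.Cruxes.EquisingularLiftNat.Sections

end
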